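import Literature.MathematicalPhysics.QuantumFieldTheory.Balaban1983to89.B8Ineq133
import Literature.MathematicalPhysics.QuantumFieldTheory.Balaban1983to89.B7Eq78Linearization

/-!
# `Balaban1983to89.B8Ineq132` — B8 pp. 76–77, 79, 99: the covariant derivative (1.1)/(1.2), the regularity
# class `𝔄_k({Ω_j}, α₀)` of (1.7)/(1.9) with its gauge invariance (1.11), the axial gauge class `Ax_k(ℭ, 1)` of
# (1.19)/(1.20), and (1.132) `U₀″ ∈ 𝔄_k({□_j}, L³α₀) ∩ Ax_k(ℭ_k, 1)` for every orbit

T. Bałaban, *Spaces of regular gauge field configurations on a lattice and gauge fixing conditions*, Commun.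
Math. Phys. **99** (1985) 75–102 `[Balaban1985RegularSpaces]` ("B8"), Sect. A pp. 76–77 (displays (1.1), (1.2),
(1.7)–(1.9), (1.11)), Sect. A p. 79 (displays (1.19), (1.20)), Sect. F pp. 98–99 (displays (1.131)–(1.133)); the
holonomy / gauge-transformation conventions (8), (9) of T. Bałaban, *Averaging operations for lattice gauge
theories*, Commun. Math. Phys. **98** (1985) 17–51 `[Balaban1985Averaging]` ("B7", "[3]" in B8).  STATUS: a
published, refereed paper; this file TYPES the printed definitions and REPRODUCES the displayed step (1.132) —
justified in print by the words "by the construction of `U₀″`" — from the tree's certified forms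
(`B8Ineq133.ineq133`, `B8Eq115GaugeFixing.ineq130_fixed`); nothing here is new mathematics and nothing here is a
claim about the Clay problem.

## THE PRINTED TEXT (quoted from the page images of pp. 76, 77, 79, 98, 99)

* p. 76, (1.1)–(1.2): "Let us recall the definition of a covariant derivative on a lattice. For a function `F`
  defined on a subset of the lattice `T_η`, with values in complex `N × N` matrices, we define
  `(D^η_{U,μ}F)(x) = η⁻¹(R(U(x, x + ηe_μ))F(x + ηe_μ) − F(x))`,
  `(D^{η*}_{U,μ}F)(x) = η⁻¹(R(U(x, x − ηe_μ))F(x − ηe_μ) − F(x))`,                                     (1.1)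
  where `U` is an arbitrary gauge field configuration, and `R(U)X = UXU⁻¹` for a unitary matrix `U` and an
  arbitrary `X`. Let `F` be a function defined at plaquettes of a subset of `T_η`. Let us denote by `p_{μν}(x)` a
  plaquette determined by the point `x` and vectors `e_μ, e_ν`, `μ < ν`, i.e.,
  `p_{μν}(x) = ⟨x, x + ηe_μ, x + ηe_μ + ηe_ν, x + ηe_ν⟩`, and let `F_{μν}(x) = F(p_{μν}(x))`. We define
  `(D^{η*}_U F)(x, x + ηe_μ) = (D^{η*}_U F)_μ(x) = Σ_{ν<μ} (D^{η*}_{U,ν}F_{νμ})(x) − Σ_{ν>μ} (D^{η*}_{U,ν}F_{μν})(x)`. (1.2)"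
* p. 77: "If `Ω ⊂ T_η`, then we denote by `Ω` also the set of bonds `⋃_{x∈Ω} st(x) = {bonds b ⊂ T_η: at least one
  end-point of `b` belongs to `Ω`}. Similarly for the corresponding set of plaquettes. … for a sequence (1.3)
  and a positive number `α₀` we define `𝔄_k({Ω_j}, α₀)` as a set of all gauge field configurations `U` on `T_η`
  satisfying the conditions
  `|U(∂p) − 1| < α₀L^{−2j}` for `p ∈ Ω_j`, `j = 0, 1, …, k`,                                            (1.7)
  or `|U(∂p) − 1| < α₀η²(Lʲη)^{−2}` for `p ⊂ Ω_j`,                                                      (1.8)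
  `|(D^{η*}_U ∂U)(b)| < α₀L^{−2j}(Lʲη)^{−1}` for `b ∈ Ω_j`, `j = 0, 1, …, k`.                              (1.9)
  We have denoted `U(∂p) = (∂U)(p)`. … Of course it is enough to assume that (1.7), (1.9) hold for
  `p, b ∈ Bʲ(Λ_j)`, because if these conditions hold for some `j = l`, then they hold for all `j < l`. These
  conditions are invariant with respect to gauge transformations. It is obvious for (1.7), (1.8). To see that
  (1.9) is invariant also let us notice that `(∂U^u)(p_{μν}(x)) = R(u(x))(∂U)(p_{μν}(x))`, and if a function `F`
  transforms as `F^u(x) = R(u(x))F(x)`, then from (1.1) we get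
  `(D^{η*}_{U^u,ν}F^u)(x) = R(u(x))(D^{η*}_{U,ν}F)(x)`.                                                  (1.11)
  This and (1.2) imply the invariance. Thus the space `𝔄_k({Ω_j}, α₀)` is invariant with respect to gauge
  transformations."  ((1.5): `Λ_j = Ω_j^{(j)} \ Ω_{j+1}^{(j)}`, `j = 0, …, k − 1`, `Λ_k = Ω_k^{(k)}`.)
* p. 79, (1.19)–(1.20): "for `x₀ ∈ Bʲ(x_j)`, `x_j ∈ Λ_j`, `1 ≤ j ≤ k`, we define a sequence of points
  `x₀, x₁, …, x_{j−1}, x_j` by the conditions `x_n ∈ B(x_{n+1})`, `n = 0, 1, …, j − 1`, and we put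
  `(R̄ⁿ_{0,x_{n+1}}Ũ′ⁿ)(Γ_{x_{n+1},x_n}) = ∏_{b⊂Γ_{x_{n+1},x_n}} R(Ū₀ⁿ(Γ_{x_{n+1},b₋}))Ũ′ⁿ_b = 1`.              (1.19)
  Let us recall that the average `Ũ′ⁿ` was defined in [3] as `Ũ′ⁿ = (U′U₀)‾ⁿ(Ū₀ⁿ)⁻¹`.                      (1.20)
  … We denote this gauge condition by `Ax_k(𝔅_k, U₀)`."
* p. 98: "Let us take a sequence of cubes `□₀, □₁, …, □_{k−1}, □_k, □`, such that `□_j ⊃ □_{j+1}` and a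
  distance between boundaries of these cubes is equal to `R₁M₁Lʲη`. … We cover `□₀` by a smallest family of
  cubes of the size `R₁M₁`. A sum of these cubes is a cube which we denote by `□̃`. A distance of its boundary
  to `□` is equal to `2R₁M₁` … thus `□̃ ⊂ Ω_{k−1}`."
* p. 99: "The sequence of cubes `{□_j}` is an admissible family of subsets satisfying (1.3), (1.4),
  `□_k ⊂ Ω_{k−1}`, `□_j ⊂ Ω_j`, `j < k`. Let us define `Λ′_j = □_j^{(j)} \ □_{j+1}^{(j)}`, `j = 1, …, k − 1`,
  `Λ′_k = □_k^{(k)}`, `Λ′₀ = T \ □₁`, `ℭ_k = ⋃_{j=0}^{k} Λ′_j`, (1.131) and let us define a configuration `U₀″` as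
  equal to `U₀′` on `□̃`, and equal to `1` outside `□̃`. It satisfies the conditions
  `U₀″ ∈ 𝔄_k({□_j}, L³α₀) ∩ Ax_k(ℭ_k, 1)`,                                                              (1.132)
  `|Ū₀″ʲ − 1| < 6dL²Mα₀` on `□_j^{(j)}`, `j = 0, 1, …, k`,                                              (1.133)
  by the construction of `U₀″`, and the inequality (1.130)."

## WHAT IS CERTIFIED HERE (kernel, axioms `propext`/`Classical.choice`/`Quot.sound` only)

On the `ℤ^d` lattices of the lineage (`B7Prop1Explicit`: sites `Fin d → ℤ`, bond fields `Site d → Fin d → 𝔸ˣ`,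
holonomy (9) `hol`, gauge action (8) `gaugeAct`), for a complete normed `ℂ`-algebra `𝔸` (so `M_N(ℂ)`):
* §1 `R(U)X = UXU⁻¹` is the tree's `B7Eq78Linearization.conjR` ((56) of [3]; reused with its `conjR_sub`,
  `conjR_smul_real`); `plaqF` (`F_{μν}(x) = U(∂p_{μν}(x))`), **`covDeriv`** = the backward covariant
  derivative `D^{η*}_{U,ν}` of (1.1) and **`covDiv`** = the covariant divergence `(D^{η*}_U ∂U)_μ(x)` of (1.2);
  **(1.11)** `covDeriv_gaugeAct` and the covariance `covDiv_gaugeAct` of (1.2) (`(D^{η*}_{U^u}∂U^u)_μ(x) =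
  R(u(x))(D^{η*}_U ∂U)_μ(x)`), with `‖R(u)X‖ = ‖X‖` for `u ∈ {|u| ≤ 1, |u⁻¹| ≤ 1}` (`norm_conjR`); the
  LOCALITY of (1.2) (`covDiv_congr`: `(D^{η*}_U ∂U)(b)` depends only on the bond variables within sup-distance
  `1` of an end-point of `b`).
* §2 **`InAk L k η α₀ Ω U`** = "`U ∈ 𝔄_k({Ω_j}, α₀)`": (1.7) and (1.9) at every level `j ≤ k` for the plaquettes
  and bonds with at least one corner / end-point in `Ω_j` (the p. 77 convention), `CondAt` = the two conditions at
  one level on one set; (1.8) ⟺ (1.7) (`threshold_18`); **gauge invariance** of `𝔄_k` (`inAk_gaugeAct_iff`,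
  p. 77 last paragraph); "it is enough to assume that (1.7), (1.9) hold for `p, b ∈ Bʲ(Λ_j)`"
  (`inAk_of_layers`, with the monotonicity `condAt_mono` behind "if these conditions hold for some `j = l`, then
  they hold for all `j < l`").
* §3 **`InAxOne L k Λ U`** = "`U ∈ Ax_k(ℭ, 1)`", `ℭ = ⋃ Λ_j`: (1.19) with `U₀ = 1`, i.e. (since `1̄ⁿ = 1`,
  `avgIter_one`, so `R(Ū₀ⁿ(·)) = id` and `Ũ′ⁿ = Ūⁿ` in (1.20)) `Ūⁿ(Γ_{x_{n+1},x_n}) = 1` for every chain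
  `x_n ∈ B(x_{n+1})` below a point `x_j ∈ Λ_j`, `1 ≤ j ≤ k` (`Under L m x z` = "`z ∈ Bᵐ(x)`"); `inAxOne_of_tower`:
  (1.15) on the tower of cubes (the form certified in `B8Ineq133.ineq133` (iv)) gives `Ax_k(ℭ, 1)` for every `ℭ`
  whose level-`j` pieces lie in `□̃^{(j)}`.
* §4 the deviation hypothesis (1.7) of `B8Ineq133.ineq133` on the finest cube from `U₀ ∈ 𝔄_k({Ω_j}, α₀)` and
  "`□̃ ⊂ Ω_{k−1}`" (`pdevOn_lt_of_inAk`, through the finiteness of the plaquette set of a box, `pdevOn_lt_of_forall`);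
  the p. 98 margin arithmetic `Σ_{j≤k} Lʲ + 1 ≤ 2Lᵏ` (`geom_margin`, the integer twin of `B8.sectF_collar_margin`:
  the distance of `∂□̃` to `□₀` is `R₁M₁(2Lᵏ − Σ_{j≤k} Lʲ)·η ≥ R₁M₁η ≥ η`) and `collar_of_margin`.
* §5 **`inAk_cutCfg_gaugeAct`**: for EVERY gauge transformation `u` with values in `{|u| ≤ 1, |u⁻¹| ≤ 1}` the
  cut-off `U₀″` of `U₀^{u}` to the finest cube lies in `𝔄_k({□_j}, L³α₀)` whenever `U₀ ∈ 𝔄_k({Ω_j}, α₀)`,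
  `□_j ⊂ Ω_j` (`j < k`), `□_k ⊂ Ω_{k−1}` and every `□_j` keeps sup-distance `≥ 1` from the complement of `□̃`;
  **`ineq132`**: print's `U₀″ = B8Ineq133.cutFixed L lo hi U₀ k y` satisfies (1.132) — both memberships — and
  (1.133), under the hypotheses of `B8Ineq133.ineq133` with its (1.7)-hypothesis REPLACED by
  `U₀ ∈ 𝔄_k({Ω_j}, α₀)` + "`□̃ ⊂ Ω_{k−1}`", plus the same inclusions / collar for `{□_j}` and `Λ′_j ⊂ □̃^{(j)}`
  (`1 ≤ j ≤ k`) for `ℭ_k = ⋃ Λ′_j`.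
  Level arithmetic behind `L³`: `α₀L^{−2(k−1)} = L²·α₀L^{−2k} ≤ L³α₀L^{−2k}` for (1.7) and
  `α₀L^{−2(k−1)}(L^{k−1}η)^{−1} = L³·α₀L^{−2k}(Lᵏη)^{−1}` for (1.9) (`thr7_le_cube`, `thr9_le_cube`).

## DICTIONARY / HONEST SCOPE

* `T_η` ↦ `ℤ^d` with the lattice spacing carried by the explicit parameter `η > 0` of (1.1)/(1.9) (print:
  `η = L^{−k}·(unit)`; the thresholds of (1.7) do not involve `η`, cf. (1.8)); complex `N × N` matrices ↦ a
  complete normed `ℂ`-algebra `𝔸`, `|·|` ↦ its norm, "unitary" ↦ the subgroup `{|u| ≤ 1, |u⁻¹| ≤ 1}` (`U1`) or an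
  `AvgClosed` gauge group `G ≤ U1` as in the lineage; `U(x, x − e_ν) = U(x − e_ν, x)⁻¹` ((9) of [3]).
* "p ∈ Ω_j" / "b ∈ Ω_j" ↦ `PlaqTouches` / `BondTouches` (at least one corner / end-point in `Ω_j`, p. 77);
  plaquettes `p_{μν}(x)` are taken for all `μ ≠ ν` (for `μ > ν` the same plaquette with the reversed boundary,
  `U(∂p)⁻¹`; immaterial for unitary values, `B7Prop1Explicit.norm_inv_sub_one_le`).
* The admissibility conditions (1.3)/(1.4) on `{Ω_j}` are NOT part of `InAk` (they constrain the family, not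
  `U`); the theorems take exactly the inclusions they use as hypotheses ("`□_j ⊂ Ω_j`", "`□_k ⊂ Ω_{k−1}`",
  "`□̃ ⊂ Ω_{k−1}`", and the collar "distance of `∂□̃` to `□₀` … `≥ R₁M₁η ≥ η`" as `Collar`), in the unified form
  `∃ l ≤ k, j ≤ l + 1 ∧ □_j ⊂ Ω_l`.
* `Bʲ(Λ_j)` as a set of sites of `T_η` ↦ `layer Ω k j = Ω_j \ Ω_{j+1}` (`j < k`), `Ω_k` (`j = k`) — equal to
  print's `Bʲ(Ω_j^{(j)} \ Ω_{j+1}^{(j)})` under (1.4).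
* `Ax_k(ℭ, U₀)` is typed for `U₀ = 1` only (the case of (1.132)); the block `B(y) = Ly + [0, L)^d` and the contour
  `Γ_{y,x}` from the corner `Ly` are those of the lineage (`B7Prop1Explicit.axialFn`, B5 (1.6) CORNER convention);
  `ℭ_k` of (1.131) is any family `Λ` with `Λ_j ⊂ □̃^{(j)}` (print's `Λ′_j ⊂ □_j^{(j)} ⊂ □̃^{(j)}`); `Λ′₀` carries no
  condition in (1.19) (`1 ≤ j`).
* NOT typed: (1.10) (needs `Re tr`); the forward derivative `D^η_{U,μ}` of (1.1) is typed (`covDerivFwd`) but not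
  used; everything after (1.133).
-/

noncomputable section

open scoped BigOperators
open NormedSpace Finset

namespace Literature.MathematicalPhysics.QuantumFieldTheory.Balaban1983to89.B8Ineq132

open B7Prop1Explicit B7Prop2Explicit B7Prop1Local B7AvgGaugeCovariance B8Ineq130 B8Eq115GaugeFixing B8Ineq133
open B7Eq78Linearization (conjR conjR_apply conjR_sub conjR_smul_real)

-- `Site` alone would resolve to the torus sites of `Setup.lean`; re-export the `ℤ^d` sites of `B7Prop1Explicit`.
export B7Prop1Explicit (Site)

variable {d : ℕ}

/-! ## §0. Sets of bonds and plaquettes (p. 77), stencils, collars, blocks -/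

section Geometry

/-- "b ∈ Ω": the bond `⟨x, x + e_μ⟩` has at least one end-point in `Ω` (p. 77: "we denote by `Ω` also the set of
bonds `⋃_{x∈Ω} st(x) = {bonds b ⊂ T_η: at least one end-point of b belongs to Ω}`").
[cite: Balaban1985RegularSpaces, p.77 (convention before (1.5))] -/
def BondTouches (Ω : Set (Site d)) (x : Site d) (μ : Fin d) : Prop :=
  x ∈ Ω ∨ x + e μ ∈ Ω

/-- "p ∈ Ω": the plaquette `p_{μν}(x) = ⟨x, x + e_μ, x + e_μ + e_ν, x + e_ν⟩` has at least one corner in `Ω`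
(p. 77: "Similarly for the corresponding set of plaquettes"). [cite: Balaban1985RegularSpaces, p.77 (convention before (1.5))] -/
def PlaqTouches (Ω : Set (Site d)) (x : Site d) (μ ν : Fin d) : Prop :=
  x ∈ Ω ∨ x + e μ ∈ Ω ∨ x + e ν ∈ Ω ∨ x + e μ + e ν ∈ Ω

/-- The set of sites on which `(D^{η*}_U ∂U)(⟨x, x + e_μ⟩)` depends (the corners of the plaquettes `p_{νμ}(x)`,
`p_{νμ}(x − e_ν)`, `ν ≠ μ`): `x_μ ≤ y_μ ≤ x_μ + 1` and `x_i − 1 ≤ y_i ≤ x_i + 1` for `i ≠ μ`. [folklore] -/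
def Stencil (μ : Fin d) (x y : Site d) : Prop :=
  ∀ i, (if i = μ then x i else x i - 1) ≤ y i ∧ y i ≤ x i + 1

/-- COLLAR: every site at sup-distance `≤ 1` from `S` lies in the box `[lo, hi]` (print, p. 98: the distance of the
boundary of `□̃` to `□₀ ⊃ □_j` is `≥ R₁M₁η ≥ η`). [cite: Balaban1985RegularSpaces, p.98 (construction of □̃)] -/
def Collar (S : Set (Site d)) (lo hi : Site d) : Prop :=
  ∀ v ∈ S, ∀ y : Site d, (∀ i, v i - 1 ≤ y i ∧ y i ≤ v i + 1) → InBox lo hi y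

/-- "`z ∈ Bᵐ(x)`": the site `z` of the `m`-times finer lattice lies in the `m`-fold block of `x`,
`Lᵐx + [0, Lᵐ)^d` (the block `B(y) = Ly + [0, L)^d` of B5 (1.6) iterated). [cite: Balaban1985RegularSpaces, p.79 ("x₀ ∈ Bʲ(x_j)")] -/
def Under (L m : ℕ) (x z : Site d) : Prop :=
  ∀ i, (L : ℤ) ^ m * x i ≤ z i ∧ z i + 1 ≤ (L : ℤ) ^ m * (x i + 1)

/-- `Bʲ(Λ_j)` as a set of sites: `Ω_j \ Ω_{j+1}` for `j < k`, `Ω_k` for `j = k` ((1.5)/(1.6) under (1.4)).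
[cite: Balaban1985RegularSpaces, (1.5)-(1.6) p.77] -/
def layer (Ω : ℕ → Set (Site d)) (k j : ℕ) : Set (Site d) :=
  {x | x ∈ Ω j ∧ (j < k → x ∉ Ω (j + 1))}

/-- A corner `v ∈ Ω_j`, `j ≤ k`, of a nested-or-not family lies in `Bˡ(Λ_l)` for the largest `l ∈ [j, k]` with
`v ∈ Ω_l`. [folklore] -/
theorem exists_layer {Ω : ℕ → Set (Site d)} {k j : ℕ} {v : Site d} (hjk : j ≤ k) (hv : v ∈ Ω j) :
    ∃ l, j ≤ l ∧ l ≤ k ∧ v ∈ layer Ω k l := by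
  classical
  refine ⟨Nat.findGreatest (fun l => v ∈ Ω l) k, Nat.le_findGreatest (P := fun l => v ∈ Ω l) hjk hv,
    Nat.findGreatest_le k, Nat.findGreatest_spec (P := fun l => v ∈ Ω l) hjk hv, fun hlt hmem => ?_⟩
  exact Nat.findGreatest_is_greatest (P := fun l => v ∈ Ω l) (Nat.lt_succ_self _) (by omega) hmem

/-- Coordinates of `x + s e_ν + t e_μ`. [folklore] -/
theorem add_zsmul_add_zsmul_apply (x : Site d) (s t : ℤ) (ν μ i : Fin d) :
    (x + s • e ν + t • e μ) i = x i + (if i = ν then s else 0) + (if i = μ then t else 0) := by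
  rw [add_zsmul_e_apply, add_zsmul_e_apply]

/-- Membership in the stencil of `⟨x, x + e_μ⟩` from coordinates `y = x + s e_ν + t e_μ`, `|s| ≤ 1`, `0 ≤ t ≤ 1`,
`ν ≠ μ`. [folklore] -/
theorem stencil_of_eq {μ ν : Fin d} (hνμ : ν ≠ μ) {x y : Site d} (s t : ℤ) (hs : -1 ≤ s ∧ s ≤ 1)
    (ht : 0 ≤ t ∧ t ≤ 1) (hy : y = x + s • e ν + t • e μ) : Stencil μ x y := by
  intro i
  rw [hy, add_zsmul_add_zsmul_apply]
  by_cases hiμ : i = μ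
  · subst hiμ
    simp only [if_true, if_neg hνμ.symm]
    omega
  · simp only [if_neg hiμ]
    split_ifs <;> omega

/-- The base point `x` lies in its stencil. [folklore] -/
theorem stencil_self (μ : Fin d) (x : Site d) : Stencil μ x x := fun i => by
  split_ifs <;> constructor <;> omega

/-- A bond with an end-point in `S` has its whole stencil in the box, if `S` has a collar. [folklore] -/
theorem stencil_inBox {S : Set (Site d)} {lo hi : Site d} (hS : Collar S lo hi) {x : Site d} {μ : Fin d}
    (hb : BondTouches S x μ) {y : Site d} (hy : Stencil μ x y) : InBox lo hi y := by
  rcases hb with hv | hv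
  · exact hS x hv y fun i => by have := hy i; split_ifs at this <;> constructor <;> omega
  · refine hS (x + e μ) hv y fun i => ?_
    have := hy i
    rw [add_e_apply]
    split_ifs at this ⊢ <;> constructor <;> omega

/-- A plaquette `p_{μν}(x)`, `μ ≠ ν`, with a corner in `S` lies in the box, if `S` has a collar (the two corners
`x`, `x + e_μ + e_ν` suffice, `B7Prop1Local.PlaqIn`). [folklore] -/
theorem plaq_inBox {S : Set (Site d)} {lo hi : Site d} (hS : Collar S lo hi) {x : Site d} {μ ν : Fin d}
    (hμν : μ ≠ ν) (hp : PlaqTouches S x μ ν) : InBox lo hi x ∧ InBox lo hi (x + e μ + e ν) := by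
  have hc : ∀ i, (x + e μ + e ν) i = x i + (if i = μ then 1 else 0) + (if i = ν then 1 else 0) := fun i => by
    rw [add_e_apply, add_e_apply]
  rcases hp with hv | hv | hv | hv
  · exact ⟨hS x hv x fun i => by constructor <;> omega,
      hS x hv _ fun i => by rw [hc]; split_ifs <;> constructor <;> omega⟩
  · refine ⟨hS _ hv x fun i => ?_, hS _ hv _ fun i => ?_⟩
    · rw [add_e_apply]; split_ifs <;> constructor <;> omega
    · rw [hc, add_e_apply]; split_ifs <;> constructor <;> omega
  · refine ⟨hS _ hv x fun i => ?_, hS _ hv _ fun i => ?_⟩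
    · rw [add_e_apply]; split_ifs <;> constructor <;> omega
    · rw [hc, add_e_apply]; split_ifs <;> constructor <;> omega
  · refine ⟨hS _ hv x fun i => ?_, hS _ hv _ fun i => ?_⟩
    · rw [hc]; split_ifs <;> constructor <;> omega
    · constructor <;> omega

/-- A set contained in a box `[A, B]` whose unit neighbourhood is inside `[lo, hi]` has a collar.
[cite: Balaban1985RegularSpaces, p.98 (distance of ∂□̃ to □)] -/
theorem collar_of_margin {S : Set (Site d)} {A B lo hi : Site d} (hS : ∀ v ∈ S, A ≤ v ∧ v ≤ B)
    (hlo : ∀ i, lo i + 1 ≤ A i) (hhi : ∀ i, B i + 1 ≤ hi i) : Collar S lo hi := fun v hv y hy i => by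
  have h1 : A i ≤ v i := (hS v hv).1 i
  have h2 : v i ≤ B i := (hS v hv).2 i
  have h3 : v i - 1 ≤ y i ∧ y i ≤ v i + 1 := hy i
  have h4 := hlo i
  have h5 := hhi i
  constructor <;> omega

/-- **The p. 98 margin, integer form**: `Σ_{j=0}^{k} Lʲ + 1 ≤ 2Lᵏ` for `L ≥ 2`; hence the distance of `∂□̃` to
`□₀`, `(2R₁M₁Lᵏ − R₁M₁Σ_{j≤k}Lʲ)·η`, is at least `R₁M₁η ≥ η` — one lattice spacing of collar (the real-number twin
is `B8.sectF_collar_margin`). [cite: Balaban1985RegularSpaces, p.98 (construction of □_j, □̃)] -/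
theorem geom_margin {L : ℕ} (hL : 2 ≤ L) : ∀ k : ℕ, ∑ j ∈ range (k + 1), L ^ j + 1 ≤ 2 * L ^ k
  | 0 => by simp
  | k + 1 => by
    have ih := geom_margin hL k
    rw [Finset.sum_range_succ, pow_succ]
    have : 2 * L ^ k ≤ L ^ k * L := by rw [mul_comm (L ^ k) L]; exact Nat.mul_le_mul_right _ hL
    omega

/-- **Descent in the tower**: if `x` lies in the depth-`m₀` cube `[tlo m₀, thi m₀]` of `B8Ineq130` then every
`z ∈ Bᵐ(x)` lies in the depth-`(m₀ + m)` cube ("□_j is a sum of the big blocks", p. 98).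
[cite: Balaban1985RegularSpaces, p.98 ("for every j the cube □_j is a sum of the big blocks")] -/
theorem under_tower {L : ℕ} {lo hi : Site d} {m₀ m : ℕ} {x z : Site d} (hx : tlo L lo m₀ ≤ x)
    (hx' : x ≤ thi L hi m₀) (hz : Under L m x z) :
    tlo L lo (m₀ + m) ≤ z ∧ z ≤ thi L hi (m₀ + m) := by
  have hL0 : (0 : ℤ) ≤ (L : ℤ) ^ m := by positivity
  constructor <;> intro i
  · have h1 : tlo L lo m₀ i ≤ x i := hx i
    rw [tlo_apply] at h1 ⊢
    have h2 := mul_le_mul_of_nonneg_left h1 hL0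
    have h3 := (hz i).1
    calc (L : ℤ) ^ (m₀ + m) * lo i = (L : ℤ) ^ m * ((L : ℤ) ^ m₀ * lo i) := by ring
      _ ≤ z i := h2.trans h3
  · have h1 : x i ≤ thi L hi m₀ i := hx' i
    rw [thi_apply] at h1 ⊢
    have h2 : (L : ℤ) ^ m * (x i + 1) ≤ (L : ℤ) ^ m * ((L : ℤ) ^ m₀ * (hi i + 1)) :=
      mul_le_mul_of_nonneg_left (by linarith) hL0
    have h3 := (hz i).2
    have h4 : (L : ℤ) ^ (m₀ + m) * (hi i + 1) = (L : ℤ) ^ m * ((L : ℤ) ^ m₀ * (hi i + 1)) := by ring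
    linarith

end Geometry

/-! ## §1. The covariant derivative (1.1), the covariant divergence (1.2), the covariance (1.11) -/

section Ring

variable {𝔸 : Type*} [NormedRing 𝔸]

/-! `R(U)X = UXU⁻¹` (p. 76, after (1.1)) is the tree's `B7Eq78Linearization.conjR` ((56) of [3]). -/

/-- `R(U)R(V) = R(UV)`. [folklore] -/
theorem conjR_conjR (a b : 𝔸ˣ) (X : 𝔸) : conjR a (conjR b X) = conjR (a * b) X := by
  simp only [conjR_apply, Units.val_mul, mul_inv_rev, mul_assoc]

/-- `R(1) = id`. [folklore] -/
@[simp] theorem one_conjR (X : 𝔸) : conjR 1 X = X := by simp [conjR_apply]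

/-- `R(U)` is additive: finite sums. [folklore] -/
theorem conjR_sum {ι : Type*} (a : 𝔸ˣ) (s : Finset ι) (f : ι → 𝔸) :
    conjR a (∑ i ∈ s, f i) = ∑ i ∈ s, conjR a (f i) := by
  simp only [conjR_apply, Finset.mul_sum, Finset.sum_mul]

/-- `R(U)` on a unit is conjugation in the group of units. [folklore] -/
theorem conjR_units (a X : 𝔸ˣ) : conjR a (X : 𝔸) = ((a * X * a⁻¹ : 𝔸ˣ) : 𝔸) := by
  simp only [conjR_apply, Units.val_mul]

/-- THE PLAQUETTE FIELD `F_{μν}(x) = (∂U)(p_{μν}(x)) = U(∂p_{μν}(x))`,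
`p_{μν}(x) = ⟨x, x + e_μ, x + e_μ + e_ν, x + e_ν⟩` — the holonomy (9) of [3] along `B7Prop1Explicit.plaqWord μ ν`.
[cite: Balaban1985RegularSpaces, (1.2) p.76 ("F_{μν}(x) = F(p_{μν}(x))", "U(∂p) = (∂U)(p)" p.77)] -/
def plaqF (V : Site d → Fin d → 𝔸ˣ) (μ ν : Fin d) (x : Site d) : 𝔸 :=
  ((hol V x (plaqWord μ ν) : 𝔸ˣ) : 𝔸)

/-- "`(∂U^u)(p_{μν}(x)) = R(u(x))(∂U)(p_{μν}(x))`" (p. 77): closed contours, (8) of [3].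
[cite: Balaban1985RegularSpaces, p.77 (sentence before (1.11)); Balaban1985Averaging, (8) p.18] -/
theorem plaqF_gaugeAct (u : Site d → 𝔸ˣ) (V : Site d → Fin d → 𝔸ˣ) (μ ν : Fin d) (x : Site d) :
    plaqF (gaugeAct u V) μ ν x = conjR (u x) (plaqF V μ ν x) := by
  unfold plaqF
  rw [hol_gaugeAct_closed u V x _ (disp_plaqWord μ ν), conjR_units]

end Ring

section Analytic

variable {𝔸 : Type*} [NormedRing 𝔸] [NormOneClass 𝔸]

/-- `‖R(u)X‖ ≤ ‖X‖` for `u ∈ {|u| ≤ 1, |u⁻¹| ≤ 1}`. [folklore] -/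
theorem norm_conjR_le {u : 𝔸ˣ} (hu : u ∈ U1 𝔸) (X : 𝔸) : ‖conjR u X‖ ≤ ‖X‖ := by
  rw [conjR_apply]
  calc ‖(u : 𝔸) * X * ((u⁻¹ : 𝔸ˣ) : 𝔸)‖ ≤ ‖(u : 𝔸) * X‖ * ‖((u⁻¹ : 𝔸ˣ) : 𝔸)‖ := norm_mul_le _ _
    _ ≤ ‖(u : 𝔸)‖ * ‖X‖ * ‖((u⁻¹ : 𝔸ˣ) : 𝔸)‖ := by gcongr; exact norm_mul_le _ _
    _ ≤ 1 * ‖X‖ * 1 := by gcongr; exacts [hu.1, hu.2]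
    _ = ‖X‖ := by ring

/-- `‖R(u)X‖ = ‖X‖` for `u ∈ {|u| ≤ 1, |u⁻¹| ≤ 1}` ("unitarily equivalent", [3] p. 24). [folklore] -/
theorem norm_conjR {u : 𝔸ˣ} (hu : u ∈ U1 𝔸) (X : 𝔸) : ‖conjR u X‖ = ‖X‖ := by
  refine le_antisymm (norm_conjR_le hu X) ?_
  have h := norm_conjR_le ((U1 𝔸).inv_mem hu) (conjR u X)
  rwa [conjR_conjR, inv_mul_cancel, one_conjR] at h

variable [NormedAlgebra ℂ 𝔸] [CompleteSpace 𝔸]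

omit [NormOneClass 𝔸] [CompleteSpace 𝔸] in
/-- **(1.1), first line**: the forward covariant derivative
`(D^η_{U,μ}F)(x) = η⁻¹(R(U(x, x + ηe_μ))F(x + ηe_μ) − F(x))` (typed for completeness; not used below).
[cite: Balaban1985RegularSpaces, (1.1) p.76] -/
def covDerivFwd (η : ℝ) (V : Site d → Fin d → 𝔸ˣ) (μ : Fin d) (F : Site d → 𝔸) (x : Site d) : 𝔸 :=
  η⁻¹ • (conjR (V x μ) (F (x + e μ)) - F x)

omit [NormOneClass 𝔸] [CompleteSpace 𝔸] in
/-- **(1.1), second line**: THE BACKWARD COVARIANT DERIVATIVE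
`(D^{η*}_{U,ν}F)(x) = η⁻¹(R(U(x, x − ηe_ν))F(x − ηe_ν) − F(x))`, with `U(x, x − e_ν) = U(x − e_ν, x)⁻¹` ((9) of
[3]). [cite: Balaban1985RegularSpaces, (1.1) p.76] -/
def covDeriv (η : ℝ) (V : Site d → Fin d → 𝔸ˣ) (ν : Fin d) (F : Site d → 𝔸) (x : Site d) : 𝔸 :=
  η⁻¹ • (conjR (V (x - e ν) ν)⁻¹ (F (x - e ν)) - F x)

omit [NormOneClass 𝔸] [CompleteSpace 𝔸] in
/-- **(1.2)** THE COVARIANT DIVERGENCE OF THE PLAQUETTE FIELD `F = ∂U` at the bond `⟨x, x + e_μ⟩`: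
`(D^{η*}_U ∂U)(x, x + ηe_μ) = (D^{η*}_U ∂U)_μ(x) = Σ_{ν<μ}(D^{η*}_{U,ν}F_{νμ})(x) − Σ_{ν>μ}(D^{η*}_{U,ν}F_{μν})(x)`.
[cite: Balaban1985RegularSpaces, (1.2) p.76] -/
def covDiv (η : ℝ) (V : Site d → Fin d → 𝔸ˣ) (μ : Fin d) (x : Site d) : 𝔸 :=
  ∑ ν ∈ Finset.Iio μ, covDeriv η V ν (plaqF V ν μ) x - ∑ ν ∈ Finset.Ioi μ, covDeriv η V ν (plaqF V μ ν) x

omit [NormOneClass 𝔸] [CompleteSpace 𝔸] in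
/-- **(1.11)** `(D^{η*}_{U^u,ν}F^u)(x) = R(u(x))(D^{η*}_{U,ν}F)(x)` for `F^u(x) = R(u(x))F(x)` — for an arbitrary
site function `u` with values in the units. [cite: Balaban1985RegularSpaces, (1.11) p.77] -/
theorem covDeriv_gaugeAct (η : ℝ) (u : Site d → 𝔸ˣ) (V : Site d → Fin d → 𝔸ˣ) (ν : Fin d) {F Fu : Site d → 𝔸}
    (hF : ∀ z, Fu z = conjR (u z) (F z)) (x : Site d) :
    covDeriv η (gaugeAct u V) ν Fu x = conjR (u x) (covDeriv η V ν F x) := by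
  have hb : (gaugeAct u V (x - e ν) ν)⁻¹ * u (x - e ν) = u x * (V (x - e ν) ν)⁻¹ := by
    simp only [gaugeAct, sub_add_cancel, mul_inv_rev, inv_inv]
    group
  unfold covDeriv
  rw [hF (x - e ν), hF x, conjR_conjR, hb, ← conjR_conjR, ← conjR_sub, ← conjR_smul_real]

omit [NormOneClass 𝔸] [CompleteSpace 𝔸] in
/-- **"This and (1.2) imply the invariance"** (p. 77): `(D^{η*}_{U^u}∂U^u)_μ(x) = R(u(x))(D^{η*}_U ∂U)_μ(x)`.
[cite: Balaban1985RegularSpaces, p.77 (after (1.11))] -/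
theorem covDiv_gaugeAct (η : ℝ) (u : Site d → 𝔸ˣ) (V : Site d → Fin d → 𝔸ˣ) (μ : Fin d) (x : Site d) :
    covDiv η (gaugeAct u V) μ x = conjR (u x) (covDiv η V μ x) := by
  unfold covDiv
  rw [conjR_sub, conjR_sum, conjR_sum]
  congr 1
  · exact Finset.sum_congr rfl fun ν _ => covDeriv_gaugeAct η u V ν (fun z => plaqF_gaugeAct u V ν μ z) x
  · exact Finset.sum_congr rfl fun ν _ => covDeriv_gaugeAct η u V ν (fun z => plaqF_gaugeAct u V μ ν z) x

omit [CompleteSpace 𝔸] in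
/-- **Gauge invariance of (1.9)**: `|(D^{η*}_{U^u}∂U^u)(b)| = |(D^{η*}_U ∂U)(b)|` for `u` with values in
`{|u| ≤ 1, |u⁻¹| ≤ 1}`. [cite: Balaban1985RegularSpaces, p.77 ("These conditions are invariant …")] -/
theorem norm_covDiv_gaugeAct (η : ℝ) {u : Site d → 𝔸ˣ} (hu : ∀ x, u x ∈ U1 𝔸) (V : Site d → Fin d → 𝔸ˣ)
    (μ : Fin d) (x : Site d) : ‖covDiv η (gaugeAct u V) μ x‖ = ‖covDiv η V μ x‖ := by
  rw [covDiv_gaugeAct, norm_conjR (hu x)]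

omit [NormOneClass 𝔸] [CompleteSpace 𝔸] in
/-- **LOCALITY of (1.2)**: `(D^{η*}_U ∂U)(⟨x, x + e_μ⟩)` depends only on the bond variables `U_b`, `b` inside the
stencil of the bond (the plaquettes `p_{νμ}(x)`, `p_{νμ}(x − e_ν)`, `ν ≠ μ`, and the bonds `⟨x − e_ν, x⟩`).
[folklore] -/
theorem covDiv_congr (η : ℝ) {lo hi : Site d} {V V' : Site d → Fin d → 𝔸ˣ} (h : AgreeOn lo hi V V')
    (μ : Fin d) (x : Site d) (hst : ∀ y, Stencil μ x y → InBox lo hi y) :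
    covDiv η V μ x = covDiv η V' μ x := by
  have key : ∀ ν, ν ≠ μ →
      (V (x - e ν) ν = V' (x - e ν) ν) ∧ plaqF V ν μ (x - e ν) = plaqF V' ν μ (x - e ν) ∧
        plaqF V ν μ x = plaqF V' ν μ x ∧ plaqF V μ ν (x - e ν) = plaqF V' μ ν (x - e ν) ∧
        plaqF V μ ν x = plaqF V' μ ν x := by
    intro ν hνμ
    have hx : InBox lo hi x := hst x (stencil_self μ x)
    have h1 : InBox lo hi (x - e ν) :=
      hst _ (stencil_of_eq hνμ (-1) 0 (by omega) (by omega) (by simp [sub_eq_add_neg]))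
    have h2 : InBox lo hi (x - e ν + e ν) := by rw [sub_add_cancel]; exact hx
    have h3 : InBox lo hi (x - e ν + e ν + e μ) := by
      rw [sub_add_cancel]; exact hst _ (stencil_of_eq hνμ 0 1 (by omega) (by omega) (by simp))
    have h4 : InBox lo hi (x + e ν + e μ) := hst _ (stencil_of_eq hνμ 1 1 (by omega) (by omega) (by simp))
    have h5 : InBox lo hi (x - e ν + e μ + e ν) := by
      rw [add_right_comm, sub_add_cancel]; exact hst _ (stencil_of_eq hνμ 0 1 (by omega) (by omega) (by simp))
    have h6 : InBox lo hi (x + e μ + e ν) := by rw [add_right_comm]; exact h4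
    exact ⟨h (x - e ν) ν h1 h2, congrArg _ (hol_plaqWord_congr h _ ν μ h1 h3),
      congrArg _ (hol_plaqWord_congr h _ ν μ hx h4), congrArg _ (hol_plaqWord_congr h _ μ ν h1 h5),
      congrArg _ (hol_plaqWord_congr h _ μ ν hx h6)⟩
  unfold covDiv covDeriv
  congr 1
  · refine Finset.sum_congr rfl fun ν hν => ?_
    obtain ⟨e1, e2, e3, -, -⟩ := key ν (Finset.mem_Iio.mp hν).ne
    rw [e1, e2, e3]
  · refine Finset.sum_congr rfl fun ν hν => ?_
    obtain ⟨e1, -, -, e4, e5⟩ := key ν (Finset.mem_Ioi.mp hν).ne'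
    rw [e1, e4, e5]

/-! ## §2. The class `𝔄_k({Ω_j}, α₀)` of (1.7)/(1.9), p. 77 -/

omit [NormOneClass 𝔸] [CompleteSpace 𝔸] in
/-- THE CONDITIONS (1.7) AND (1.9) AT ONE LEVEL `j` ON ONE SET `S` (thresholds `α₀L^{−2j}` and
`α₀L^{−2j}(Lʲη)^{−1}`): `|U(∂p) − 1| < α₀L^{−2j}` for the plaquettes `p ∈ S` and
`|(D^{η*}_U ∂U)(b)| < α₀L^{−2j}(Lʲη)^{−1}` for the bonds `b ∈ S` (touching convention of p. 77).
[cite: Balaban1985RegularSpaces, (1.7), (1.9) p.77] -/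
def CondAt (L : ℕ) (η α : ℝ) (j : ℕ) (S : Set (Site d)) (V : Site d → Fin d → 𝔸ˣ) : Prop :=
  (∀ (x : Site d) (μ ν : Fin d), μ ≠ ν → PlaqTouches S x μ ν →
      ‖plaqF V μ ν x - 1‖ < α * (((L : ℝ) ^ j)⁻¹) ^ 2) ∧
    ∀ (x : Site d) (μ : Fin d), BondTouches S x μ →
      ‖covDiv η V μ x‖ < α * (((L : ℝ) ^ j)⁻¹) ^ 2 * ((L : ℝ) ^ j * η)⁻¹

omit [NormOneClass 𝔸] [CompleteSpace 𝔸] in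
/-- **`U ∈ 𝔄_k({Ω_j}, α₀)`** (p. 77): "a set of all gauge field configurations `U` on `T_η` satisfying the
conditions `|U(∂p) − 1| < α₀L^{−2j}` for `p ∈ Ω_j`, `j = 0, 1, …, k`, (1.7) …
`|(D^{η*}_U ∂U)(b)| < α₀L^{−2j}(Lʲη)^{−1}` for `b ∈ Ω_j`, `j = 0, 1, …, k`. (1.9)".
[cite: Balaban1985RegularSpaces, (1.7), (1.9) p.77 (definition of 𝔄_k({Ω_j}, α₀))] -/
def InAk (L k : ℕ) (η α : ℝ) (Ω : ℕ → Set (Site d)) (V : Site d → Fin d → 𝔸ˣ) : Prop :=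
  ∀ j, j ≤ k → CondAt L η α j (Ω j) V

omit [NormOneClass 𝔸] [CompleteSpace 𝔸] in
/-- **(1.8) ⟺ (1.7)**: `α₀η²(Lʲη)^{−2} = α₀L^{−2j}`. [cite: Balaban1985RegularSpaces, (1.8) p.77] -/
theorem threshold_18 (L : ℕ) (α : ℝ) {η : ℝ} (hη : η ≠ 0) (j : ℕ) :
    α * η ^ 2 * (((L : ℝ) ^ j * η)⁻¹) ^ 2 = α * (((L : ℝ) ^ j)⁻¹) ^ 2 := by
  rw [mul_inv, mul_pow, inv_pow η]
  field_simp

omit [CompleteSpace 𝔸] in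
/-- **Gauge invariance of `𝔄_k({Ω_j}, α₀)`** (p. 77: "Thus the space `𝔄_k({Ω_j}, α₀)` is invariant with respect
to gauge transformations") — for gauge transformations with values in `{|u| ≤ 1, |u⁻¹| ≤ 1}`: (1.7) by (45) of
[3] (`norm_hol_gaugeAct_plaqWord`), (1.9) by (1.11)/(1.2) (`norm_covDiv_gaugeAct`).
[cite: Balaban1985RegularSpaces, p.77 (last paragraph), (1.11)] -/
theorem condAt_gaugeAct_iff (L : ℕ) (η α : ℝ) (j : ℕ) (S : Set (Site d)) {u : Site d → 𝔸ˣ}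
    (hu : ∀ x, u x ∈ U1 𝔸) (V : Site d → Fin d → 𝔸ˣ) :
    CondAt L η α j S (gaugeAct u V) ↔ CondAt L η α j S V := by
  unfold CondAt plaqF
  simp only [norm_hol_gaugeAct_plaqWord hu, norm_covDiv_gaugeAct η hu]

omit [CompleteSpace 𝔸] in
/-- **Gauge invariance of `𝔄_k({Ω_j}, α₀)`**, all levels. [cite: Balaban1985RegularSpaces, p.77 (last paragraph)] -/
theorem inAk_gaugeAct_iff (L k : ℕ) (η α : ℝ) (Ω : ℕ → Set (Site d)) {u : Site d → 𝔸ˣ}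
    (hu : ∀ x, u x ∈ U1 𝔸) (V : Site d → Fin d → 𝔸ˣ) :
    InAk L k η α Ω (gaugeAct u V) ↔ InAk L k η α Ω V := by
  unfold InAk
  simp only [condAt_gaugeAct_iff L η α _ _ hu]

omit [NormOneClass 𝔸] [CompleteSpace 𝔸] in
/-- The thresholds decrease with the level: for `j ≤ l` (`L ≥ 1`), `α₀L^{−2l} ≤ α₀L^{−2j}` and
`α₀L^{−2l}(Lˡη)^{−1} ≤ α₀L^{−2j}(Lʲη)^{−1}`. [folklore] -/
theorem thr_mono {L : ℕ} (hL : 1 ≤ L) {α η : ℝ} (hα : 0 ≤ α) (hη : 0 < η) {j l : ℕ} (hjl : j ≤ l) :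
    α * (((L : ℝ) ^ l)⁻¹) ^ 2 ≤ α * (((L : ℝ) ^ j)⁻¹) ^ 2 ∧
      α * (((L : ℝ) ^ l)⁻¹) ^ 2 * ((L : ℝ) ^ l * η)⁻¹ ≤ α * (((L : ℝ) ^ j)⁻¹) ^ 2 * ((L : ℝ) ^ j * η)⁻¹ := by
  have hL1 : (1 : ℝ) ≤ L := by exact_mod_cast hL
  have hpos : (0 : ℝ) < (L : ℝ) ^ j := by positivity
  have hpow : (L : ℝ) ^ j ≤ (L : ℝ) ^ l := pow_le_pow_right₀ hL1 hjl
  have hinv : ((L : ℝ) ^ l)⁻¹ ≤ ((L : ℝ) ^ j)⁻¹ := inv_anti₀ hpos hpow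
  have hinv' : ((L : ℝ) ^ l * η)⁻¹ ≤ ((L : ℝ) ^ j * η)⁻¹ :=
    inv_anti₀ (by positivity) (mul_le_mul_of_nonneg_right hpow hη.le)
  have h1 : α * (((L : ℝ) ^ l)⁻¹) ^ 2 ≤ α * (((L : ℝ) ^ j)⁻¹) ^ 2 :=
    mul_le_mul_of_nonneg_left (pow_le_pow_left₀ (by positivity) hinv 2) hα
  exact ⟨h1, mul_le_mul h1 hinv' (by positivity) (by positivity)⟩

omit [NormOneClass 𝔸] [CompleteSpace 𝔸] in
/-- "if these conditions hold for some `j = l`, then they hold for all `j < l`" (p. 77): the level-`l`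
conditions on a set imply the level-`j` conditions on it for `j ≤ l`.
[cite: Balaban1985RegularSpaces, p.77 (sentence after (1.10))] -/
theorem condAt_mono {L : ℕ} (hL : 1 ≤ L) {α η : ℝ} (hα : 0 ≤ α) (hη : 0 < η) {j l : ℕ} (hjl : j ≤ l)
    {S : Set (Site d)} {V : Site d → Fin d → 𝔸ˣ} (h : CondAt L η α l S V) : CondAt L η α j S V :=
  ⟨fun x μ ν hμν hp => (h.1 x μ ν hμν hp).trans_le (thr_mono hL hα hη hjl).1,
    fun x μ hb => (h.2 x μ hb).trans_le (thr_mono hL hα hη hjl).2⟩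

omit [NormOneClass 𝔸] [CompleteSpace 𝔸] in
/-- The conditions on a smaller set follow from those on a larger one. [folklore] -/
theorem condAt_anti {L : ℕ} {α η : ℝ} {j : ℕ} {S T : Set (Site d)} (hST : S ⊆ T)
    {V : Site d → Fin d → 𝔸ˣ} (h : CondAt L η α j T V) : CondAt L η α j S V :=
  ⟨fun x μ ν hμν hp => h.1 x μ ν hμν (by
      rcases hp with hp | hp | hp | hp
      exacts [Or.inl (hST hp), Or.inr (Or.inl (hST hp)), Or.inr (Or.inr (Or.inl (hST hp))),
        Or.inr (Or.inr (Or.inr (hST hp)))]),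
    fun x μ hb => h.2 x μ (by rcases hb with hb | hb; exacts [Or.inl (hST hb), Or.inr (hST hb)])⟩

omit [NormOneClass 𝔸] [CompleteSpace 𝔸] in
/-- **"Of course it is enough to assume that (1.7), (1.9) hold for `p, b ∈ Bʲ(Λ_j)`"** (p. 77): the conditions at
level `l` on the layers `Ω_l \ Ω_{l+1}` (`Ω_k` for `l = k`), `l ≤ k`, give `U ∈ 𝔄_k({Ω_j}, α₀)`.
[cite: Balaban1985RegularSpaces, p.77 (sentence after (1.10))] -/
theorem inAk_of_layers {L : ℕ} (hL : 1 ≤ L) {k : ℕ} {η α : ℝ} (hη : 0 < η) (hα : 0 ≤ α)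
    {Ω : ℕ → Set (Site d)} {V : Site d → Fin d → 𝔸ˣ} (h : ∀ l, l ≤ k → CondAt L η α l (layer Ω k l) V) :
    InAk L k η α Ω V := by
  intro j hjk
  constructor
  · intro x μ ν hμν hp
    have main : ∀ v, v ∈ Ω j → (∀ T : Set (Site d), v ∈ T → PlaqTouches T x μ ν) →
        ‖plaqF V μ ν x - 1‖ < α * (((L : ℝ) ^ j)⁻¹) ^ 2 := fun v hv hT => by
      obtain ⟨l, hjl, hlk, hvl⟩ := exists_layer hjk hv
      exact (condAt_mono hL hα hη hjl (h l hlk)).1 x μ ν hμν (hT _ hvl)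
    rcases hp with hv | hv | hv | hv
    exacts [main _ hv fun T hT => Or.inl hT, main _ hv fun T hT => Or.inr (Or.inl hT),
      main _ hv fun T hT => Or.inr (Or.inr (Or.inl hT)), main _ hv fun T hT => Or.inr (Or.inr (Or.inr hT))]
  · intro x μ hb
    have main : ∀ v, v ∈ Ω j → (∀ T : Set (Site d), v ∈ T → BondTouches T x μ) →
        ‖covDiv η V μ x‖ < α * (((L : ℝ) ^ j)⁻¹) ^ 2 * ((L : ℝ) ^ j * η)⁻¹ := fun v hv hT => by
      obtain ⟨l, hjl, hlk, hvl⟩ := exists_layer hjk hv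
      exact (condAt_mono hL hα hη hjl (h l hlk)).2 x μ (hT _ hvl)
    rcases hb with hv | hv
    exacts [main _ hv fun T hT => Or.inl hT, main _ hv fun T hT => Or.inr hT]

/-! ## §3. The axial gauge class `Ax_k(ℭ, 1)` of (1.19)/(1.20) with `U₀ = 1`, p. 79 -/

omit [NormOneClass 𝔸] in
/-- **`1̄ⁿ = 1`**: the averages (43) of the configuration `1` are `1` (`B8Ineq130.bavg_one` iterated) — so in
(1.19)/(1.20) with `U₀ = 1`: `R(Ū₀ⁿ(Γ_{x_{n+1},b₋})) = R(1) = id` and `Ũ′ⁿ = Ū′ⁿ`.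
[cite: Balaban1985RegularSpaces, (1.20) p.79; Balaban1985Averaging, (43) p.24] -/
theorem avgIter_one (L : ℕ) : ∀ n : ℕ, avgIter L (1 : Site d → Fin d → 𝔸ˣ) n = 1
  | 0 => rfl
  | n + 1 => by
    rw [avgIter_succ, avgIter_one L n]
    funext z κ
    rw [rescale_apply, bavg_one]
    rfl

omit [NormOneClass 𝔸] in
/-- **`U ∈ Ax_k(ℭ, 1)`**, `ℭ = ⋃_j Λ_j` — (1.19) with `U₀ = 1` (then `Ũ′ⁿ = Ūⁿ` by (1.20) and `avgIter_one`, and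
the twisted product `∏_{b⊂Γ} R(1)Ūⁿ_b` is the holonomy `Ūⁿ(Γ_{x_{n+1},x_n})`): "for `x₀ ∈ Bʲ(x_j)`, `x_j ∈ Λ_j`,
`1 ≤ j ≤ k`, we define a sequence of points `x₀, x₁, …, x_{j−1}, x_j` by the conditions `x_n ∈ B(x_{n+1})`,
`n = 0, 1, …, j − 1`, and we put `Ūⁿ(Γ_{x_{n+1},x_n}) = 1`" — here `x_{n+1} = z ∈ B^{j−n−1}(x_j)`, `x_n = Lz + r`,
`r ∈ [0, L)^d`, and `Γ_{z,x}` is the block contour from the corner `Lz` (`B7Prop1Explicit.axialFn`).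
[cite: Balaban1985RegularSpaces, (1.19)-(1.20) p.79 (definition of Ax_k(𝔅_k, U₀)), (1.132) p.99] -/
def InAxOne (L k : ℕ) (Λ : ℕ → Set (Site d)) (W : Site d → Fin d → 𝔸ˣ) : Prop :=
  ∀ j, 1 ≤ j → j ≤ k → ∀ xj ∈ Λ j, ∀ n, n < j → ∀ z : Site d, Under L (j - (n + 1)) xj z →
    ∀ r : Fin d → Fin L, axialFn (avgIter L W n) ((L : ℤ) • z) ((L : ℤ) • z + boxVec L r) = 1

omit [NormOneClass 𝔸] in
/-- **(1.15) on the tower of cubes gives `Ax_k(ℭ, 1)`** for every `ℭ` whose level-`j` pieces lie in the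
depth-`(k − j)` cube `□̃^{(j)} = [tlo (k − j), thi (k − j)]`, `1 ≤ j ≤ k` (print: `Λ′_j ⊂ □_j^{(j)} ⊂ □̃^{(j)}`).
[cite: Balaban1985RegularSpaces, (1.132) p.99 (Ax-part), (1.15) p.78, (1.19) p.79] -/
theorem inAxOne_of_tower {L : ℕ} {lo hi : Site d} {k : ℕ} {W : Site d → Fin d → 𝔸ˣ}
    (h15 : ∀ n, n < k → ∀ z, tlo L lo n ≤ z → z ≤ thi L hi n → ∀ r : Fin d → Fin L,
      axialFn (avgIter L W (k - (n + 1))) ((L : ℤ) • z) ((L : ℤ) • z + boxVec L r) = 1)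
    {Λ : ℕ → Set (Site d)}
    (hΛ : ∀ j, 1 ≤ j → j ≤ k → ∀ x ∈ Λ j, tlo L lo (k - j) ≤ x ∧ x ≤ thi L hi (k - j)) :
    InAxOne L k Λ W := by
  intro j hj1 hjk xj hxj n hn z hz r
  obtain ⟨hx, hx'⟩ := hΛ j hj1 hjk xj hxj
  obtain ⟨hz1, hz2⟩ := under_tower hx hx' hz
  have hdepth : k - j + (j - (n + 1)) = k - (n + 1) := by omega
  rw [hdepth] at hz1 hz2
  have h := h15 (k - (n + 1)) (by omega) z hz1 hz2 r
  rwa [show k - (k - (n + 1) + 1) = n by omega] at h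

/-! ## §4. From `U₀ ∈ 𝔄_k({Ω_j}, α₀)` and `□̃ ⊂ Ω_{k−1}` to the hypothesis (1.7) on the finest cube -/

omit [NormOneClass 𝔸] [NormedAlgebra ℂ 𝔸] [CompleteSpace 𝔸] in
/-- The plaquette set of a box is finite, so a strict pointwise bound is a strict bound of the supremum
`B7Prop1Local.pdevOn`. [folklore] -/
theorem pdevOn_lt_of_forall {lo hi : Site d} {V : Site d → Fin d → 𝔸ˣ} {c : ℝ} (hc : 0 < c)
    (h : ∀ (x : Site d) (μ ν : Fin d), InBox lo hi x → InBox lo hi (x + e μ + e ν) →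
      ‖((hol V x (plaqWord μ ν) : 𝔸ˣ) : 𝔸) - 1‖ < c) :
    pdevOn lo hi V < c := by
  unfold pdevOn
  have hfin : Finite {p : Site d × Fin d × Fin d // PlaqIn lo hi p} := by
    have hI : Finite (Set.Icc lo hi) := (Set.finite_Icc lo hi).to_subtype
    refine Finite.of_injective
      (fun p : {p : Site d × Fin d × Fin d // PlaqIn lo hi p} =>
        ((⟨p.1.1, ⟨fun i => (p.2.1 i).1, fun i => (p.2.1 i).2⟩⟩ : Set.Icc lo hi), p.1.2)) ?_
    intro p q hpq
    simp only [Prod.mk.injEq, Subtype.mk.injEq] at hpq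
    exact Subtype.ext (Prod.ext hpq.1 hpq.2)
  cases isEmpty_or_nonempty {p : Site d × Fin d × Fin d // PlaqIn lo hi p} with
  | inl hι => rw [Real.iSup_of_isEmpty]; exact hc
  | inr hι =>
    obtain ⟨p, hp⟩ := exists_eq_ciSup_of_finite
      (f := fun p : {p : Site d × Fin d × Fin d // PlaqIn lo hi p} =>
        ‖((hol V p.1.1 (plaqWord p.1.2.1 p.1.2.2) : 𝔸ˣ) : 𝔸) - 1‖)
    rw [← hp]
    exact h _ _ _ p.2.1 p.2.2

omit [NormOneClass 𝔸] [CompleteSpace 𝔸] in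
/-- For `j ≤ l + 1` (`L ≥ 1`): `α₀L^{−2l} ≤ L³α₀L^{−2j}` — the (1.7)-threshold of `Ω_l` against that of
`𝔄_k({□_j}, L³α₀)` (print: `l = j` for `j < k`, `l = k − 1` for `j = k`, where `α₀L^{−2(k−1)} = L²·α₀L^{−2k}`).
[cite: Balaban1985RegularSpaces, (1.132) p.99 (the constant L³α₀)] -/
theorem thr7_le_cube {L : ℕ} (hL : 1 ≤ L) {α : ℝ} (hα : 0 ≤ α) {j l : ℕ} (hjl : j ≤ l + 1) :
    α * (((L : ℝ) ^ l)⁻¹) ^ 2 ≤ (L : ℝ) ^ 3 * α * (((L : ℝ) ^ j)⁻¹) ^ 2 := by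
  have hL1 : (1 : ℝ) ≤ L := by exact_mod_cast hL
  have h1 : (L : ℝ) ^ j ≤ (L : ℝ) ^ (l + 1) := pow_le_pow_right₀ hL1 hjl
  have h2 : ((L : ℝ) ^ j) ^ 2 ≤ (L : ℝ) ^ 3 * ((L : ℝ) ^ l) ^ 2 := by
    calc ((L : ℝ) ^ j) ^ 2 ≤ ((L : ℝ) ^ (l + 1)) ^ 2 := pow_le_pow_left₀ (by positivity) h1 2
      _ = (L : ℝ) ^ 2 * ((L : ℝ) ^ l) ^ 2 := by ring
      _ ≤ (L : ℝ) ^ 3 * ((L : ℝ) ^ l) ^ 2 :=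
          mul_le_mul_of_nonneg_right (pow_le_pow_right₀ hL1 (by norm_num)) (by positivity)
  rw [inv_pow, inv_pow, ← div_eq_mul_inv, ← div_eq_mul_inv, div_le_div_iff₀ (by positivity) (by positivity)]
  calc α * ((L : ℝ) ^ j) ^ 2 ≤ α * ((L : ℝ) ^ 3 * ((L : ℝ) ^ l) ^ 2) := mul_le_mul_of_nonneg_left h2 hα
    _ = (L : ℝ) ^ 3 * α * ((L : ℝ) ^ l) ^ 2 := by ring

omit [NormOneClass 𝔸] [CompleteSpace 𝔸] in
/-- For `j ≤ l + 1` (`L ≥ 1`, `η > 0`): `α₀L^{−2l}(Lˡη)^{−1} ≤ L³α₀L^{−2j}(Lʲη)^{−1}` — the (1.9)-threshold of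
`Ω_l` against that of `𝔄_k({□_j}, L³α₀)` (for `l = k − 1`, `j = k` this is the equality
`α₀L^{−2(k−1)}(L^{k−1}η)^{−1} = L³·α₀L^{−2k}(Lᵏη)^{−1}`). [cite: Balaban1985RegularSpaces, (1.132) p.99 (the constant L³α₀)] -/
theorem thr9_le_cube {L : ℕ} (hL : 1 ≤ L) {α η : ℝ} (hα : 0 ≤ α) (hη : 0 < η) {j l : ℕ} (hjl : j ≤ l + 1) :
    α * (((L : ℝ) ^ l)⁻¹) ^ 2 * ((L : ℝ) ^ l * η)⁻¹ ≤
      (L : ℝ) ^ 3 * α * (((L : ℝ) ^ j)⁻¹) ^ 2 * ((L : ℝ) ^ j * η)⁻¹ := by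
  have hL1 : (1 : ℝ) ≤ L := by exact_mod_cast hL
  have h1 : (L : ℝ) ^ j ≤ (L : ℝ) ^ (l + 1) := pow_le_pow_right₀ hL1 hjl
  have h2 : ((L : ℝ) ^ j) ^ 3 ≤ (L : ℝ) ^ 3 * ((L : ℝ) ^ l) ^ 3 := by
    calc ((L : ℝ) ^ j) ^ 3 ≤ ((L : ℝ) ^ (l + 1)) ^ 3 := pow_le_pow_left₀ (by positivity) h1 3
      _ = (L : ℝ) ^ 3 * ((L : ℝ) ^ l) ^ 3 := by ring
  have e1 : α * (((L : ℝ) ^ l)⁻¹) ^ 2 * ((L : ℝ) ^ l * η)⁻¹ = α / (((L : ℝ) ^ l) ^ 3 * η) := by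
    field_simp
  have e2 : (L : ℝ) ^ 3 * α * (((L : ℝ) ^ j)⁻¹) ^ 2 * ((L : ℝ) ^ j * η)⁻¹ =
      (L : ℝ) ^ 3 * α / (((L : ℝ) ^ j) ^ 3 * η) := by
    field_simp
  rw [e1, e2, div_le_div_iff₀ (by positivity) (by positivity)]
  calc α * (((L : ℝ) ^ j) ^ 3 * η) = α * η * ((L : ℝ) ^ j) ^ 3 := by ring
    _ ≤ α * η * ((L : ℝ) ^ 3 * ((L : ℝ) ^ l) ^ 3) := mul_le_mul_of_nonneg_left h2 (by positivity)
    _ = (L : ℝ) ^ 3 * α * (((L : ℝ) ^ l) ^ 3 * η) := by ring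

omit [NormOneClass 𝔸] [CompleteSpace 𝔸] in
/-- **The hypothesis (1.7) of `B8Ineq133.ineq133` / `B8Eq115GaugeFixing.ineq130_fixed` on the finest cube from
`U₀ ∈ 𝔄_k({Ω_j}, α₀)`**: if the cube `[tlo k, thi k]` (`□̃`) lies in some `Ω_l`, `k ≤ l + 1` (print:
"`□̃ ⊂ Ω_{k−1}`", p. 98), then `sup_{p ⊂ □̃} |U₀(∂p) − 1| < α₀L²·L^{−2k}` (`= α₀L^{−2(k−1)}`).
[cite: Balaban1985RegularSpaces, p.98 ("thus □̃ ⊂ Ω_{k−1}"), (1.7) p.77] -/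
theorem pdevOn_lt_of_inAk {L : ℕ} (hL : 1 ≤ L) {k : ℕ} {η α : ℝ} (hα : 0 < α) {Ω : ℕ → Set (Site d)}
    {U : Site d → Fin d → 𝔸ˣ} (hA : InAk L k η α Ω U) {lo hi : Site d}
    (hΩ : ∃ l, l ≤ k ∧ k ≤ l + 1 ∧ ∀ x, InBox (tlo L lo k) (thi L hi k) x → x ∈ Ω l) :
    pdevOn (tlo L lo k) (thi L hi k) U < α * (L : ℝ) ^ 2 * (((L : ℝ) ^ k)⁻¹) ^ 2 := by
  obtain ⟨l, hlk, hkl, hsub⟩ := hΩ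
  have hL1 : (1 : ℝ) ≤ L := by exact_mod_cast hL
  have hthr : α * (((L : ℝ) ^ l)⁻¹) ^ 2 ≤ α * (L : ℝ) ^ 2 * (((L : ℝ) ^ k)⁻¹) ^ 2 := by
    have h1 : (L : ℝ) ^ k ≤ (L : ℝ) ^ (l + 1) := pow_le_pow_right₀ hL1 hkl
    have h2 : ((L : ℝ) ^ k) ^ 2 ≤ (L : ℝ) ^ 2 * ((L : ℝ) ^ l) ^ 2 := by
      calc ((L : ℝ) ^ k) ^ 2 ≤ ((L : ℝ) ^ (l + 1)) ^ 2 := pow_le_pow_left₀ (by positivity) h1 2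
        _ = (L : ℝ) ^ 2 * ((L : ℝ) ^ l) ^ 2 := by ring
    rw [inv_pow, inv_pow, ← div_eq_mul_inv, ← div_eq_mul_inv,
      div_le_div_iff₀ (by positivity) (by positivity)]
    calc α * ((L : ℝ) ^ k) ^ 2 ≤ α * ((L : ℝ) ^ 2 * ((L : ℝ) ^ l) ^ 2) := mul_le_mul_of_nonneg_left h2 hα.le
      _ = α * (L : ℝ) ^ 2 * ((L : ℝ) ^ l) ^ 2 := by ring
  refine pdevOn_lt_of_forall (by positivity) fun x μ ν hx hx' => ?_
  rcases eq_or_ne μ ν with rfl | hμν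
  · rw [hol_plaqWord_self, Units.val_one, sub_self, norm_zero]; positivity
  · exact ((hA l hlk).1 x μ ν hμν (Or.inl (hsub x hx))).trans_le hthr

/-! ## §5. (1.132): `U₀″ ∈ 𝔄_k({□_j}, L³α₀) ∩ Ax_k(ℭ_k, 1)` -/

omit [CompleteSpace 𝔸] in
/-- **(1.132), `𝔄`-part, for every gauge transformation**: let `U₀ ∈ 𝔄_k({Ω_j}, α₀)`, let `u` take values in
`{|u| ≤ 1, |u⁻¹| ≤ 1}`, and let `U₀″` be the cut-off (`B8Ineq133.cutCfg`) of `U₀^{u}` to the finest cube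
`□̃ = [tlo k, thi k]` ("equal to `U₀′` on `□̃`, and equal to `1` outside `□̃`"). If every `□_j`, `j ≤ k`, lies in
some `Ω_l` with `l ≤ k`, `j ≤ l + 1` (print: "`□_k ⊂ Ω_{k−1}`, `□_j ⊂ Ω_j`, `j < k`") and keeps one lattice spacing
of collar inside `□̃` (print, p. 98: distance `≥ R₁M₁η`), then `U₀″ ∈ 𝔄_k({□_j}, L³α₀)`: on the plaquettes and
bonds of `□_j` the cut-off agrees with `U₀^{u}` (locality `B8Ineq130.hol_plaqWord_congr`, `covDiv_congr`), whose
deviations (1.7)/(1.9) equal those of `U₀` (gauge invariance (45)/(1.11)), which are `< α₀L^{−2l} ≤ L³α₀L^{−2j}`,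
resp. `< α₀L^{−2l}(Lˡη)^{−1} ≤ L³α₀L^{−2j}(Lʲη)^{−1}`.
[cite: Balaban1985RegularSpaces, (1.132) p.99, (1.7)/(1.9)/(1.11) p.77, p.98] -/
theorem inAk_cutCfg_gaugeAct {L : ℕ} (hL : 1 ≤ L) {k : ℕ} {η α : ℝ} (hη : 0 < η) (hα : 0 ≤ α)
    {Ω sq : ℕ → Set (Site d)} {U : Site d → Fin d → 𝔸ˣ} (hA : InAk L k η α Ω U) {u : Site d → 𝔸ˣ}
    (hu : ∀ x, u x ∈ U1 𝔸) {lo hi : Site d}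
    (hsq : ∀ j, j ≤ k → ∃ l, l ≤ k ∧ j ≤ l + 1 ∧ sq j ⊆ Ω l)
    (hcol : ∀ j, j ≤ k → Collar (sq j) (tlo L lo k) (thi L hi k)) :
    InAk L k η ((L : ℝ) ^ 3 * α) sq (cutCfg (tlo L lo k) (thi L hi k) (gaugeAct u U)) := by
  intro j hj
  obtain ⟨l, hlk, hjl, hsub⟩ := hsq j hj
  obtain ⟨h7, h9⟩ := hA l hlk
  have hag : AgreeOn (tlo L lo k) (thi L hi k) (cutCfg (tlo L lo k) (thi L hi k) (gaugeAct u U))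
      (gaugeAct u U) := cutCfg_agree _ _ _
  constructor
  · intro x μ ν hμν hp
    obtain ⟨hx, hx'⟩ := plaq_inBox (hcol j hj) hμν hp
    have hp' : PlaqTouches (Ω l) x μ ν := by
      rcases hp with hp | hp | hp | hp
      exacts [Or.inl (hsub hp), Or.inr (Or.inl (hsub hp)), Or.inr (Or.inr (Or.inl (hsub hp))),
        Or.inr (Or.inr (Or.inr (hsub hp)))]
    unfold plaqF
    rw [hol_plaqWord_congr hag x μ ν hx hx', norm_hol_gaugeAct_plaqWord hu]
    exact (h7 x μ ν hμν hp').trans_le (thr7_le_cube hL hα hjl)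
  · intro x μ hb
    have hb' : BondTouches (Ω l) x μ := by
      rcases hb with hb | hb
      exacts [Or.inl (hsub hb), Or.inr (hsub hb)]
    rw [covDiv_congr η hag μ x fun y hy => stencil_inBox (hcol j hj) hb hy, norm_covDiv_gaugeAct η hu]
    exact (h9 x μ hb').trans_le (thr9_le_cube hL hα hη hjl)

/-- **(1.132) AND (1.133), p. 99, FOR EVERY ORBIT, LOCAL CARRIER.**  Printed: "let us define a configuration `U₀″`
as equal to `U₀′` on `□̃`, and equal to `1` outside `□̃`. It satisfies the conditions
`U₀″ ∈ 𝔄_k({□_j}, L³α₀) ∩ Ax_k(ℭ_k, 1)`, (1.132) `|Ū₀″ʲ − 1| < 6dL²Mα₀` on `□_j^{(j)}`, `j = 0, 1, …, k`, (1.133)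
by the construction of `U₀″`, and the inequality (1.130)."  Certified form, for `U₀″ = B8Ineq133.cutFixed L lo hi
U₀ k y` (the cut-off to `□̃ = [tlo k, thi k]` of `U₀′ = U₀^{u}`, `u` the block axial tower gauge of
`B8Eq115GaugeFixing` with top center `y`): for every `G`-valued `U₀ ∈ 𝔄_k({Ω_j}, α₀)` (`G` an `AvgClosed` gauge
group, `η > 0` the lattice spacing of (1.1)/(1.9)) such that `□̃` lies in some `Ω_l`, `k ≤ l + 1` ("`□̃ ⊂ Ω_{k−1}`"),
every `□_j`, `j ≤ k`, lies in some `Ω_l`, `j ≤ l + 1` ("`□_k ⊂ Ω_{k−1}`, `□_j ⊂ Ω_j`, `j < k`") with one lattice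
spacing of collar in `□̃`, every `Λ′_j`, `1 ≤ j ≤ k`, lies in `□̃^{(j)}`, and the Prop. 1/2 smallness of [3] and the
size hypotheses of `B8Eq115GaugeFixing.ineq130_fixed` hold (`2h ≤ M + 4R₁M₁` for the half-width `h` of the top cube
`[lo, hi]` around `y`, `R₁M₁ ≤ M`, `11d < M`, `11d²L²α₀ + (M + 4R₁M₁)dL²α₀ ≤ 1/6`):
(1.132) `U₀″ ∈ 𝔄_k({□_j}, L³α₀)` (`InAk`) and `U₀″ ∈ Ax_k(ℭ_k, 1)` (`InAxOne`), and (1.133) on every bond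
`⟨x, x + e_ν⟩` of every `□̃^{(j)}`, `j = k − n`: `|Ū₀″ʲ(x, x + e_ν) − 1| < 6dL²Mα₀`.
Proof: `inAk_cutCfg_gaugeAct` with `u ∈ G ≤ U1` (`ineq130_fixed`), `inAxOne_of_tower` on member (iv) of
`B8Ineq133.ineq133`, member (v) of `B8Ineq133.ineq133`; its hypothesis (1.7) on `□̃` is `pdevOn_lt_of_inAk`.
[cite: Balaban1985RegularSpaces, (1.132)-(1.133) p.99, (1.7)/(1.9) p.77, (1.19) p.79, p.98] -/
theorem ineq132 (L : ℕ) (hL : 2 ≤ L) (hd : 1 ≤ d) {G : Subgroup 𝔸ˣ} (hG : AvgClosed d L G) (k : ℕ)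
    (U : Site d → Fin d → 𝔸ˣ) (hU : ∀ x κ, U x κ ∈ G) {α₀ : ℝ} (hα : 0 < α₀)
    (hα3 : C0 d * (α₀ * (L : ℝ) ^ 2) ≤ 1 / 3) (hα2 : 2 * (α₀ * (L : ℝ) ^ 2) ≤ c2' d L)
    (lo hi : Site d) (hlohi : lo ≤ hi) {η : ℝ} (hη : 0 < η) {Ω : ℕ → Set (Site d)}
    (hA : InAk L k η α₀ Ω U)
    (hΩ : ∃ l, l ≤ k ∧ k ≤ l + 1 ∧ ∀ x, InBox (tlo L lo k) (thi L hi k) x → x ∈ Ω l)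
    {sq : ℕ → Set (Site d)} (hsq : ∀ j, j ≤ k → ∃ l, l ≤ k ∧ j ≤ l + 1 ∧ sq j ⊆ Ω l)
    (hcol : ∀ j, j ≤ k → Collar (sq j) (tlo L lo k) (thi L hi k))
    {Λ : ℕ → Set (Site d)} (hΛ : ∀ j, 1 ≤ j → j ≤ k → ∀ x ∈ Λ j, tlo L lo (k - j) ≤ x ∧ x ≤ thi L hi (k - j))
    {y : Site d} {h : ℕ} (hy : lo ≤ y) (hy' : y ≤ hi) (hrad : ∀ κ, y κ - lo κ ≤ h ∧ hi κ - y κ ≤ h)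
    {M R₁ M₁ : ℝ} (hside : 2 * (h : ℝ) ≤ M + 4 * R₁ * M₁) (hRM : R₁ * M₁ ≤ M) (hM : 11 * (d : ℝ) < M)
    (hsmall : 11 * (d : ℝ) ^ 2 * (L : ℝ) ^ 2 * α₀ + (M + 4 * R₁ * M₁) * d * (L : ℝ) ^ 2 * α₀ ≤ 1 / 6) :
    InAk L k η ((L : ℝ) ^ 3 * α₀) sq (cutFixed L lo hi U k y) ∧
    InAxOne L k Λ (cutFixed L lo hi U k y) ∧
    ∀ (n : ℕ), n ≤ k → ∀ (x : Site d) (ν : Fin d), tlo L lo n ≤ x → x + e ν ≤ thi L hi n →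
      ‖((avgIter L (cutFixed L lo hi U k y) (k - n) x ν : 𝔸ˣ) : 𝔸) - 1‖ < 6 * d * (L : ℝ) ^ 2 * M * α₀ := by
  have hL1 : 1 ≤ L := le_trans (by norm_num) hL
  have h17 : pdevOn (tlo L lo k) (thi L hi k) U < α₀ * (L : ℝ) ^ 2 * (((L : ℝ) ^ k)⁻¹) ^ 2 :=
    pdevOn_lt_of_inAk hL1 hα hA hΩ
  have huG := (ineq130_fixed L hL hd hG k U hU hα hα3 hα2 lo hi hlohi h17 hy hy' hrad hside hRM hM hsmall).1
  have huU : ∀ x, localGauge L lo hi U k y x ∈ U1 𝔸 := fun x => hG.le_U1 (huG x)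
  obtain ⟨-, -, -, h15, -, h133⟩ :=
    ineq133 L hL hd hG k U hU hα hα3 hα2 lo hi hlohi h17 hy hy' hrad hside hRM hM hsmall
  exact ⟨inAk_cutCfg_gaugeAct hL1 hη hα.le hA huU hsq hcol, inAxOne_of_tower h15 hΛ, h133⟩

end Analytic

end Literature.MathematicalPhysics.QuantumFieldTheory.Balaban1983to89.B8Ineq132
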